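import Summits.CriticalPhenomena.SAWScalingLimit.Theses.SAWTwistedSelfEnergy
import Summits.CriticalPhenomena.SAWScalingLimit.Theorems.SAWRenewalTightnessTightOfShellCrossing
import HarnessLib

/-!
# Line `Sketch` (= crux-ideate r2 k4 `SketchIdeatorR2K4.lean`, card `Ideas/dead-end-restriction-ks.md`) —
# skeleton of record for crux stmt-CriticalPhenomena-1881 `SAWTwistedSelfEnergy.EventualTight`

Lead a1 (prover-line-stmt-CriticalPhenomena-1881-a1-0), 2026-08-17.  Registration v1.

The line: ATOM `UniformDeadEndRestriction` (uniform dead-end restriction lower bound `UDR C q n₁` for the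
critical `ℤ²` SAW — the definitions below are copied VERBATIM from the ideator's sketch
`Cruxes/EventualTight/SketchIdeatorR2K4.lean`, namespace `…IdeatorR2K4`) + PORT `PortKS` (= the sketch's `StubA`:
Kemppainen–Smirnov 2017 Lemma 3.6 / Prop. 3.5 with dead-end inputs ⇒ Aizenman–Burchard (H1) with shell-dependent
thresholds = `SAWRenewalTightness.ShellCrossingBound`, stmt-CriticalPhenomena-4728) + LANDED glue
(`TightOfShellCrossing_proof`, p-landed item stmt-4732; set form → along the mesh by
`isTightAlongMesh_of_isTightMeasureSet_image`).

Stubs (registered; sorries ONLY here): `stub_udr : UniformDeadEndRestriction`, `stub_portKS : PortKS`.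
`EventualTight_of` concludes the crux BY NAME from the two `__Registered` aliases (rfl-equal to the stubs).
-/

noncomputable section

open MeasureTheory Filter Topology Set Metric
open scoped ENNReal NNReal
open Literature.Probability.RandomPlanarGeometry Literature.Probability.LatticeModels

namespace Summit.CriticalPhenomena.SAWScalingLimit.Cruxes.EventualTight.LineSketchR2K4

/-! ## The atom (verbatim from `SketchIdeatorR2K4.lean`) -/

/-- Self-avoiding lattice paths `c → b` of `ℤ²` with all vertices in `Λ`. -/
def LatPath (Λ : Set (Site 2)) (c b : Site 2) : Type :=
  {p : (zdGraph 2).Walk c b // p.IsPath ∧ ∀ v ∈ p.support, v ∈ Λ}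

/-- `x_c`-mass `Z_Λ(c,b) = Σ_{SAW c→b in Λ} x_c^{|ω|}` (an `ℝ≥0∞`-valued `tsum`; finite for finite `Λ`). -/
def mass (Λ : Set (Site 2)) (c b : Site 2) : ENNReal :=
  ∑' p : LatPath Λ c b, ENNReal.ofReal (SAW.criticalFugacity ^ p.1.length)

/-- `v` is cut from `x` by the mouth `K` inside `Λ`: every `Λ`-path from `v` to `x` meets `K`
(if `x ∈ K` this holds trivially). -/
def CutFrom (Λ K : Set (Site 2)) (x v : Site 2) : Prop :=
  ∀ p : (zdGraph 2).Walk v x, (∀ w ∈ p.support, w ∈ Λ) → ∃ w ∈ p.support, w ∈ K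

/-- The DEAD-END POCKET behind the mouth `K`: vertices of `Λ ∖ K` cut from BOTH endpoints by `K`. -/
def pocket (Λ K : Set (Site 2)) (c b : Site 2) : Set (Site 2) :=
  {v | v ∈ Λ ∧ v ∉ K ∧ CutFrom Λ K c v ∧ CutFrom Λ K b v}

/-- **UDR C q n₁ — Uniform Dead-end Restriction bound** for the critical `ℤ²` SAW (the atom of the card,
verbatim). -/
def UDR (C q : ℝ) (n₁ : ℕ) : Prop :=
  ∀ (Λ K : Set (Site 2)) (c b : Site 2) (z₀ : ℂ) (r : ℝ), Λ.Finite → K ⊆ Λ → (n₁ : ℝ) ≤ r →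
    ((∀ v ∈ K, dist (Site.toComplex v) z₀ ≤ r) →
      ENNReal.ofReal (1 - q) * mass Λ c b ≤
        mass (Λ \ {v | v ∈ pocket Λ K c b ∧ C * r ≤ dist (Site.toComplex v) z₀}) c b) ∧
    ((∀ v ∈ K, C * r ≤ dist (Site.toComplex v) z₀) →
      ENNReal.ofReal (1 - q) * mass Λ c b ≤
        mass (Λ \ {v | v ∈ pocket Λ K c b ∧ dist (Site.toComplex v) z₀ ≤ r}) c b)

/-- The atom of the line, existentially packaged (`∃ C q n₁`). -/
def UniformDeadEndRestriction : Prop :=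
  ∃ C q : ℝ, ∃ n₁ : ℕ, 1 < C ∧ q < 1 ∧ UDR C q n₁

/-- The PORT (the sketch's `StubA`): the monochromatic Kemppainen–Smirnov engine on `δℤ²` — the atom implies
Aizenman–Burchard (H1) with shell-dependent thresholds, i.e. `ShellCrossingBound` (stmt-CriticalPhenomena-4728). -/
def PortKS : Prop :=
  UniformDeadEndRestriction →
    Summit.CriticalPhenomena.SAWScalingLimit.Theses.SAWRenewalTightness.ShellCrossingBound

/-! ## The stubs (the ONLY sorries of the file) -/

/-- STUB (atom, hardest; held by the lead): the uniform dead-end restriction bound. -/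
theorem stub_udr : UniformDeadEndRestriction := by
  sorry

/-- STUB (port): `UniformDeadEndRestriction → ShellCrossingBound` (KS17 Lemma 3.6 + Prop. 3.5 + AB99 on `δℤ²`). -/
theorem stub_portKS : PortKS := by
  sorry

/-! ### Name-keyed aliases (device of `Lines/birth.lean` / `Lines/SketchIdeator2_1881.lean`) -/
namespace __Registered

/-- Alias of the registered signature of `stub_udr`. -/
abbrev stub_udr : Prop := UniformDeadEndRestriction

/-- Alias of the registered signature of `stub_portKS`. -/
abbrev stub_portKS : Prop := PortKS

end __Registered

/-! ## The skeleton theorem: the stubs imply the crux, BY NAME -/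

/-- **`SAWTwistedSelfEnergy.EventualTight` from the two registered stubs** (no `sorry` of its own): the port gives
`ShellCrossingBound`, the landed `TightOfShellCrossing_proof` (stmt-4732) gives the set-form eventual tightness, and
`isTightAlongMesh_of_isTightMeasureSet_image` transports it along `𝓝[>] 0` (the SAW observable is measurable for the
discrete σ-algebra). [cite: AizenmanBurchardDuke1999, Thms 1.1-1.2] [cite: KemppainenSmirnov2017, Prop. 3.5] -/
theorem EventualTight_of (hU : __Registered.stub_udr) (hP : __Registered.stub_portKS) :
    Summit.CriticalPhenomena.SAWScalingLimit.Theses.SAWTwistedSelfEnergy.EventualTight := by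
  intro D a b hab
  obtain ⟨δ₀, hδ₀, hT⟩ :=
    Summit.CriticalPhenomena.SAWScalingLimit.Theorems.TightOfShellCrossing_proof (hP hU) D a b hab
  exact isTightAlongMesh_of_isTightMeasureSet_image
    (Eventually.of_forall fun δ => (SAW.DomainSAW.measurable_of_top _).aemeasurable) hδ₀ hT

/-- **Wiring check — the crux proof modulo the stubs.** -/
example : Summit.CriticalPhenomena.SAWScalingLimit.Theses.SAWTwistedSelfEnergy.EventualTight :=
  EventualTight_of stub_udr stub_portKS

end Summit.CriticalPhenomena.SAWScalingLimit.Cruxes.EventualTight.LineSketchR2K4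

end
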